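import Summits.HodgeConjecture.HodgeConjecture.Theses.HolomorphicityRate
import Literature.AlgebraicGeometry.HodgeTheory.HodgeTypeConjugation

/-!
# Route HolomorphicityRate — `RateGapPinnedOfCarriers` (item stmt-HodgeConjecture-18208)

Pure-logic glue of the carrier split: `CarrierCurvatureDecay → AHGlobalisationWithRate → RateGapPinned`
(the conclusion spelled out verbatim in the route decl).  For `X` smooth projective of dimension `n`,
`1 ≤ p < n`, a Chern-normalised Hodge model `A`, a hard-Lefschetz datum `Λ` with Kähler class, and a
rational class `c` of Hodge type `(p,p)`:

* the summit's `∃`-form Hodge-type hypothesis `IsOfHodgeType n X (2p) p p c` is moved into the model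
  `A` (`A.pullback (2p) c ∈ A.hodgePQ (2p) p p`) by the PROVED transport
  `IsOfHodgeType.mem_hodgePQ` (Voisin I, Prop. 6.11 / §7.3.2, discharged in the tree);
* R1a (`CarrierCurvatureDecay`) hands out the carrier `(g, F, m, C, δ, D)` with
  `(-1)^{p-1}(p-1)!·ch_p(F) = m·A^*c`;
* R1b (`AHGlobalisationWithRate`), fed with `(Λ, g, F, C, δ, D)`, returns `d ≥ 1`, `C'` and,
  eventually in `k`, zero loci `S_k` (bad set `∅`) of defect `≤ C'·k^{-(p+δ)}` carrying
  `(-1)^{p-1}(p-1)!·ch_p(F) + (k^p·d)·A^*h^p = A^*(m·c + (k^p·d)·h^p)` (linearity of `A.pullback`);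
* witnesses: the same `g, m, d`, budget constant `C := 1` with `a_k := k^p`, the same `δ, C'`,
  `Sg := ∅`; eventually ⇒ frequently.

Adapted from the planner/strategist candidate `rateGapPinnedOfCarriers_holds`
(`Cruxes/CarrierCurvatureDecay/SketchR1.lean`, attached as evidence on the item).
-/

-- `Summit.HodgeConjecture.HodgeConjecture.Theorems` is the mandated namespace (single-problem summit:
-- Problem = Summit), which `linter.dupNamespace` flags on every declaration; the lakefile turns the
-- linter off for the Summits library (weak option), restated here so stand-alone elaboration is warning-free.
set_option linter.dupNamespace false

namespace Summit.HodgeConjecture.HodgeConjecture.Theorems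

open Literature.AlgebraicGeometry.HodgeTheory

/-- **Item stmt-HodgeConjecture-18208 (`RateGapPinnedOfCarriers`)**: the glue
`CarrierCurvatureDecay → AHGlobalisationWithRate → RateGapPinned` of route HolomorphicityRate.
Take the carrier `(g, F, m, C, δ, D)` of R1a for `(A, c)` (the Hodge-type hypothesis transported into
the model `A` by `IsOfHodgeType.mem_hodgePQ`), feed it to R1b with `(Λ, g)` to get `d`, `C'` and
eventually-in-`k` zero loci `S_k` (`Sg = ∅`) carrying
`(-1)^{p-1}(p-1)!·ch_p(F) + (k^p d)·A^*h^p = A^*(m·c + (k^p d)·h^p)` by linearity of `A.pullback` and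
the Chern identity of R1a; budget `a_k := k^p`, `C := 1`; eventually ⇒ frequently.  The type is
literally the route decl
`Summit.HodgeConjecture.HodgeConjecture.Theses.HolomorphicityRate.RateGapPinnedOfCarriers`. -/
theorem rateGapPinnedOfCarriers_proof :
    Summit.HodgeConjecture.HodgeConjecture.Theses.HolomorphicityRate.RateGapPinnedOfCarriers := by
  unfold Summit.HodgeConjecture.HodgeConjecture.Theses.HolomorphicityRate.RateGapPinnedOfCarriers
  intro h₁ h₂ n p X hX hp1 hpn A hA Λ hΛK c hc hH
  obtain ⟨g, F, m, C, δ, D, hm, hδ, hrank, hlow, htop, hdec⟩ :=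
    h₁ n p X hX hp1 hpn A hA c hc (hH.mem_hodgePQ hX A)
  obtain ⟨d, C', hd, hev⟩ := h₂ n p X hX hp1 hpn A hA Λ hΛK g F C δ D hδ hrank hlow hdec
  refine ⟨g, m, d, 1, fun k => k ^ p, δ, C', hm, hd, fun k => by push_cast; simp, hδ,
    (hev.mono fun k hk => ?_).frequently⟩
  obtain ⟨S, hS, hcar⟩ := hk
  refine ⟨S, ∅, hS, ?_⟩
  have key : A.pullback (2 * p) ((m : ℂ) • c + ((k ^ p * d : ℕ) : ℂ) • cupPowTwo Λ.hyperplaneClass p) =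
      ((-1 : ℂ) ^ (p - 1) * ((p - 1).factorial : ℂ)) • F.chernCharacter A.deRham p +
        ((k ^ p * d : ℕ) : ℂ) • A.pullback (2 * p) (cupPowTwo Λ.hyperplaneClass p) := by
    rw [map_add, map_smul, map_smul, htop]
  simpa only [key] using hcar

end Summit.HodgeConjecture.HodgeConjecture.Theorems
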